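import Literature.MathematicalPhysics.QuantumLattice.FermionicTreeExpansion
import HarnessLib

/-!
# The truncated expectation of determinant moments is linear in each row of the propagator matrix

For the cluster map `c : F → ι` (field pairs to clusters), a propagator matrix `G : Matrix F F R` and the
determinant moments `moment c G Q = det G|_{fields of Q}` (`FermionicTreeExpansion`), the Ursell
(truncated) function `W ↦ ursellOf (moment c G) W` of `UrsellInversion` is, as a function of the ROW `a`
of `G` (all other rows fixed):

* constant if the cluster `c a` of `a` is not in `W` (`ursellOf_moment_updateRow_of_not_mem`);
* additive and homogeneous — i.e. LINEAR — if `c a ∈ W` (`ursellOf_moment_updateRow_add`,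
  `ursellOf_moment_updateRow_smul`).

Reason: in every partition product `∏_{P ∈ π} 𝓔ᵀ(P)` of the Möbius recursion exactly one block contains
`c a`, its factor is linear in row `a` by induction, and the other factors do not see row `a`; the
moment `det G|_W` itself is linear in each row. This is the Leibniz structure behind the derivative of
the connected coefficients of a fermionic expansion along a one-parameter family of propagators
(`d/dh 𝓔ᵀ(G(h)) = Σ_a 𝓔ᵀ(G(h) with row a replaced by ∂_h G(h)_a)`), used to control the source
dependence of single-scale expansions.

* `submatrix_enum_updateRow_of_not_mem`, `moment_updateRow_of_not_mem` — rows outside the fields of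
  `Q` do not enter `moment c G Q`;
* `exists_enum_eq`, `submatrix_enum_updateRow_of_eq`, `moment_updateRow_add`, `moment_updateRow_smul` —
  linearity of the moment in a row of a field of `Q`;
* **`ursellOf_moment_updateRow_of_not_mem`**, **`ursellOf_moment_updateRow_add`**,
  **`ursellOf_moment_updateRow_smul`** — the same for the Ursell function;
* `ursellOf_moment_updateRow_sub`, `ursellOf_moment_updateRow_zero` — consequences.

Everything is PROVED; no definition and no named fact.

## References

* D. Ruelle, *Statistical Mechanics: Rigorous Results* (1969), §4.4.1 (4.5)–(4.7) (Ursell functions by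
  Möbius inversion). [cite: Ruelle1969, §4.4.1 (4.5)-(4.7)]
* V. Mastropietro, *Non-Perturbative Renormalization* (2008), §2.8 (2.79) (determinant moments).
  [cite: Mastropietro2008, §2.8 (2.79)]
-/

noncomputable section

open Finset Literature.Probability.LatticeModels

namespace Literature.MathematicalPhysics.QuantumLattice

namespace FermionicTree

variable {ι : Type*} [DecidableEq ι] {F : Type*} [Fintype F] [LinearOrder F] {R : Type*} [CommRing R]
variable (c : F → ι)

/-! ### Rows outside the fields of `Q` -/

omit [CommRing R] in
/-- The restriction to the fields of `Q` does not see a row whose cluster is not in `Q`. [folklore] -/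
theorem submatrix_enum_updateRow_of_not_mem (G : Matrix F F R) {Q : Finset ι} {a : F} (ha : c a ∉ Q)
    (r : F → R) :
    (G.updateRow a r).submatrix (enum c Q) (enum c Q) = G.submatrix (enum c Q) (enum c Q) := by
  ext i j
  simp only [Matrix.submatrix_apply, Matrix.updateRow_apply]
  rw [if_neg]
  intro h
  exact ha (h ▸ c_enum_mem c Q i)

/-- Hence the moment of `Q` does not see such a row. [folklore] -/
theorem moment_updateRow_of_not_mem (G : Matrix F F R) {Q : Finset ι} {a : F} (ha : c a ∉ Q) (r : F → R) :
    moment c (G.updateRow a r) Q = moment c G Q := by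
  unfold moment
  rw [submatrix_enum_updateRow_of_not_mem c G ha r]

/-! ### Rows of fields of `Q`: linearity of the moment -/

/-- A field whose cluster is in `Q` is enumerated. [folklore] -/
theorem exists_enum_eq {Q : Finset ι} {a : F} (ha : c a ∈ Q) : ∃ k, enum c Q k = a := by
  have h : a ∈ Set.range ((fieldsOf c Q).orderEmbOfFin rfl) := by
    rw [Finset.range_orderEmbOfFin, Finset.mem_coe, mem_fieldsOf]
    exact ha
  exact h

omit [CommRing R] in
/-- Updating an enumerated row commutes with the restriction. [folklore] -/
theorem submatrix_enum_updateRow_of_eq (G : Matrix F F R) {Q : Finset ι} {a : F}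
    {k : Fin (fieldsOf c Q).card} (hk : enum c Q k = a) (r : F → R) :
    (G.updateRow a r).submatrix (enum c Q) (enum c Q) =
      (G.submatrix (enum c Q) (enum c Q)).updateRow k (r ∘ enum c Q) := by
  ext i j
  simp only [Matrix.submatrix_apply, Matrix.updateRow_apply, Function.comp_apply]
  have hiff : (enum c Q i = a) ↔ (i = k) := by
    rw [← hk]
    exact (enum c Q).injective.eq_iff
  simp only [hiff]

/-- **The moment is additive in a row of a field of `Q`.** [folklore] -/
theorem moment_updateRow_add (G : Matrix F F R) {Q : Finset ι} {a : F} (ha : c a ∈ Q) (r₁ r₂ : F → R) :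
    moment c (G.updateRow a (r₁ + r₂)) Q = moment c (G.updateRow a r₁) Q + moment c (G.updateRow a r₂) Q := by
  obtain ⟨k, hk⟩ := exists_enum_eq c ha
  unfold moment
  rw [submatrix_enum_updateRow_of_eq c G hk, submatrix_enum_updateRow_of_eq c G hk,
    submatrix_enum_updateRow_of_eq c G hk]
  exact Matrix.det_updateRow_add _ k (r₁ ∘ enum c Q) (r₂ ∘ enum c Q)

/-- **The moment is homogeneous in a row of a field of `Q`.** [folklore] -/
theorem moment_updateRow_smul (G : Matrix F F R) {Q : Finset ι} {a : F} (ha : c a ∈ Q) (s : R) (r : F → R) :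
    moment c (G.updateRow a (s • r)) Q = s * moment c (G.updateRow a r) Q := by
  obtain ⟨k, hk⟩ := exists_enum_eq c ha
  unfold moment
  rw [submatrix_enum_updateRow_of_eq c G hk, submatrix_enum_updateRow_of_eq c G hk]
  exact Matrix.det_updateRow_smul _ k s (r ∘ enum c Q)

/-! ### The Ursell function -/

/-- **The Ursell function of `W` does not see a row whose cluster is not in `W`.** [cite: Ruelle1969, §4.4.1 (4.5)-(4.7)] -/
theorem ursellOf_moment_updateRow_of_not_mem {a : F} (G : Matrix F F R) (r : F → R) :
    ∀ (W : Finset ι), c a ∉ W → ursellOf (moment c (G.updateRow a r)) W = ursellOf (moment c G) W := by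
  intro W
  induction W using Finset.strongInduction with
  | H W ih =>
    intro ha
    rw [ursellOf_eq, ursellOf_eq, moment_updateRow_of_not_mem c G ha r]
    congr 1
    refine sum_congr rfl fun π hπ => prod_congr rfl fun P hP => ?_
    obtain ⟨hne, hπ'⟩ := mem_erase.1 hπ
    have hsp := mem_setPartitions.1 hπ'
    exact ih P (hsp.ssubset_of_ne_singleton hne hP) fun haP => ha (hsp.subset hP haP)

/-- In a partition of `W ∋ c a`, the blocks other than the block of `c a` do not see row `a`. [folklore] -/
theorem prod_erase_blockOf_ursellOf_updateRow {W : Finset ι} {π : Finset (Finset ι)}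
    (hsp : IsSetPartition W π) {a : F} (ha : c a ∈ W) (G : Matrix F F R) (r : F → R) :
    ∏ P ∈ π.erase (blockOf π (c a)), ursellOf (moment c (G.updateRow a r)) P =
      ∏ P ∈ π.erase (blockOf π (c a)), ursellOf (moment c G) P := by
  refine prod_congr rfl fun P hP => ?_
  obtain ⟨hPne, hPπ⟩ := mem_erase.1 hP
  refine ursellOf_moment_updateRow_of_not_mem c G r P fun haP => hPne ?_
  exact hsp.eq_of_mem hPπ (hsp.blockOf_mem ha) haP (hsp.mem_blockOf ha)

/-- **The Ursell function is additive in a row of a field of one of its clusters.**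
[cite: Ruelle1969, §4.4.1 (4.5)-(4.7)] -/
theorem ursellOf_moment_updateRow_add {a : F} (G : Matrix F F R) (r₁ r₂ : F → R) :
    ∀ (W : Finset ι), c a ∈ W →
      ursellOf (moment c (G.updateRow a (r₁ + r₂))) W =
        ursellOf (moment c (G.updateRow a r₁)) W + ursellOf (moment c (G.updateRow a r₂)) W := by
  intro W
  induction W using Finset.strongInduction with
  | H W ih =>
    intro ha
    rw [ursellOf_eq, ursellOf_eq, ursellOf_eq, moment_updateRow_add c G ha]
    have hsum : ∑ π ∈ (setPartitions W).erase {W}, ∏ P ∈ π, ursellOf (moment c (G.updateRow a (r₁ + r₂))) P =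
        ∑ π ∈ (setPartitions W).erase {W}, ∏ P ∈ π, ursellOf (moment c (G.updateRow a r₁)) P +
          ∑ π ∈ (setPartitions W).erase {W}, ∏ P ∈ π, ursellOf (moment c (G.updateRow a r₂)) P := by
      rw [← sum_add_distrib]
      refine sum_congr rfl fun π hπ => ?_
      obtain ⟨hne, hπ'⟩ := mem_erase.1 hπ
      have hsp := mem_setPartitions.1 hπ'
      have hP₀ : blockOf π (c a) ∈ π := hsp.blockOf_mem ha
      have haP₀ : c a ∈ blockOf π (c a) := hsp.mem_blockOf ha
      rw [← mul_prod_erase π _ hP₀, ← mul_prod_erase π _ hP₀, ← mul_prod_erase π _ hP₀,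
        prod_erase_blockOf_ursellOf_updateRow c hsp ha G (r₁ + r₂),
        prod_erase_blockOf_ursellOf_updateRow c hsp ha G r₁,
        prod_erase_blockOf_ursellOf_updateRow c hsp ha G r₂,
        ih _ (hsp.ssubset_of_ne_singleton hne hP₀) haP₀, add_mul]
    rw [hsum]
    ring

/-- **The Ursell function is homogeneous in a row of a field of one of its clusters.**
[cite: Ruelle1969, §4.4.1 (4.5)-(4.7)] -/
theorem ursellOf_moment_updateRow_smul {a : F} (G : Matrix F F R) (s : R) (r : F → R) :
    ∀ (W : Finset ι), c a ∈ W →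
      ursellOf (moment c (G.updateRow a (s • r))) W = s * ursellOf (moment c (G.updateRow a r)) W := by
  intro W
  induction W using Finset.strongInduction with
  | H W ih =>
    intro ha
    rw [ursellOf_eq, ursellOf_eq, moment_updateRow_smul c G ha]
    have hsum : ∑ π ∈ (setPartitions W).erase {W}, ∏ P ∈ π, ursellOf (moment c (G.updateRow a (s • r))) P =
        s * ∑ π ∈ (setPartitions W).erase {W}, ∏ P ∈ π, ursellOf (moment c (G.updateRow a r)) P := by
      rw [mul_sum]
      refine sum_congr rfl fun π hπ => ?_
      obtain ⟨hne, hπ'⟩ := mem_erase.1 hπ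
      have hsp := mem_setPartitions.1 hπ'
      have hP₀ : blockOf π (c a) ∈ π := hsp.blockOf_mem ha
      have haP₀ : c a ∈ blockOf π (c a) := hsp.mem_blockOf ha
      rw [← mul_prod_erase π _ hP₀, ← mul_prod_erase π _ hP₀,
        prod_erase_blockOf_ursellOf_updateRow c hsp ha G (s • r),
        prod_erase_blockOf_ursellOf_updateRow c hsp ha G r,
        ih _ (hsp.ssubset_of_ne_singleton hne hP₀) haP₀, mul_assoc]
    rw [hsum]
    ring

/-- The row at zero: `𝓔ᵀ_W(G with row a := 0) = 0` when `c a ∈ W`. [folklore] -/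
theorem ursellOf_moment_updateRow_zero {a : F} (G : Matrix F F R) {W : Finset ι} (ha : c a ∈ W) :
    ursellOf (moment c (G.updateRow a 0)) W = 0 := by
  have h := ursellOf_moment_updateRow_smul c G (0 : R) (0 : F → R) W ha
  rw [zero_smul, zero_mul] at h
  exact h

/-- The difference formula: `𝓔ᵀ_W(G with row a := r₁) - 𝓔ᵀ_W(G with row a := r₂) = 𝓔ᵀ_W(G with row a := r₁ - r₂)`
when `c a ∈ W`. [folklore] -/
theorem ursellOf_moment_updateRow_sub {a : F} (G : Matrix F F R) (r₁ r₂ : F → R) {W : Finset ι}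
    (ha : c a ∈ W) :
    ursellOf (moment c (G.updateRow a r₁)) W - ursellOf (moment c (G.updateRow a r₂)) W =
      ursellOf (moment c (G.updateRow a (r₁ - r₂))) W := by
  have h := ursellOf_moment_updateRow_add c G (r₁ - r₂) r₂ W ha
  rw [sub_add_cancel] at h
  rw [h, add_sub_cancel_right]

/-- `G` is `G` with its own row: `G.updateRow a (G a) = G` — deprecated alias of Mathlib's
`Matrix.updateRow_eq_self`, which the proof below uses directly (librarian dedup-02649). [folklore] -/
@[deprecated Matrix.updateRow_eq_self (since := "2026-08-17")]
alias updateRow_self_row := Matrix.updateRow_eq_self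

/-- **The increment of the Ursell function along a change of one row**:
`𝓔ᵀ_W(G') - 𝓔ᵀ_W(G) = 𝓔ᵀ_W(G with row a := G'_a - G_a)` when `G'` and `G` agree off row `a` and
`c a ∈ W` (the one-row Leibniz step behind `d/dh 𝓔ᵀ(G(h))`). [folklore] -/
theorem ursellOf_moment_sub_of_eq_off_row {a : F} (G G' : Matrix F F R) (hGG' : ∀ i, i ≠ a → G' i = G i)
    {W : Finset ι} (ha : c a ∈ W) :
    ursellOf (moment c G') W - ursellOf (moment c G) W = ursellOf (moment c (G.updateRow a (G' a - G a))) W := by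
  have hG' : G' = G.updateRow a (G' a) := by
    ext i j
    rw [Matrix.updateRow_apply]
    split_ifs with h
    · rw [h]
    · rw [hGG' i h]
  conv_lhs => rw [hG', ← Matrix.updateRow_eq_self G a]
  rw [Matrix.updateRow_idem]
  exact ursellOf_moment_updateRow_sub c G (G' a) (G a) ha

end FermionicTree

end Literature.MathematicalPhysics.QuantumLattice
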